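import Mathlib.Analysis.Calculus.ParametricIntegral
import Mathlib.Analysis.Calculus.Deriv.MeanValue
import Mathlib.Analysis.SpecialFunctions.Log.Deriv
import Mathlib.Analysis.SpecialFunctions.ExpDeriv
import Mathlib.MeasureTheory.Function.SpecialFunctions.Basic
import Mathlib.MeasureTheory.Integral.Bochner.Basic
import Summits.AtomisticToContinuum.BoseEinsteinCondensation.Theorems.BECCutLineWeakDisorderAcrossCutDefs

/-!
# Route `BECCutLineWeakDisorder`, crux `TwoReplicaTransienceBound` (stmt-AtomisticToContinuum-9687):
# line `across-cut-thinning` (v2), the tilt DEVICE `stub_tiltFTC`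

Proof of the registered stub `stub_tiltFTC : Goal.stub_tiltFTC` (`= TiltFTC`, stated in
`Theorems/BECCutLineWeakDisorderAcrossCutDefs.lean`) of the checked skeleton
`Cruxes/TwoReplicaTransienceBound/Lines/across_cut_thinning.lean`. Pure real analysis over Mathlib.

**Statement.** On a finite measure space, for bounded measurable `A, A' ≥ 0`, write
`M_{ij}(s,t) = ∫ A^i A'^j e^{-(sA+tA')} dμ` (`tiltLaplace μ A A' s t i j`) and `Λ = M₀₀`. If the
tilted covariance is bounded in the multiplicative form `M₁₁M₀₀ ≤ M₁₀M₀₁ + B·M₀₀²` on `[0,1]²`,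
then `Λ(1,1)Λ(0,0) ≤ e^{B} Λ(1,0)Λ(0,1)`.

**Proof.** `μ = 0`: `0 ≤ 0`. Otherwise every `M₀₀(s,t) > 0` (`integral_exp_pos`).
(a) `s ↦ M_{ij}(s,t)` has derivative `-M_{i+1,j}(s,t)` at every real `s` (differentiation under
the integral sign, `hasDerivAt_integral_of_dominated_loc_of_deriv_le`: on the unit ball around `s₀`
the `s`-derivative of the integrand is bounded by the constant `M^{i+1} M^j e^{(|s₀|+1)M+|t|M}`,
integrable on a finite measure); the `t`-derivative `-M_{i,j+1}` follows from the symmetry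
`(A,s,i) ↔ (A',t,j)` (`tiltLaplace_swap`).
(b) For `t ∈ [0,1]`, `g(s) = -M₀₁/M₀₀` has `g' = (M₁₁M₀₀ - M₀₁M₁₀)/M₀₀² ≤ B` on `(0,1)` (the
hypothesis divided by `M₀₀² > 0`), so `g(1) - g(0) ≤ B` (`Convex.image_sub_le_mul_sub_of_deriv_le`
on `Icc 0 1`).
(c) `h(t) = log M₀₀(1,t) - log M₀₀(0,t)` has `h'(t) = g_t(1) - g_t(0) ≤ B`, so `h(1) - h(0) ≤ B`;
exponentiate. Steps (b)–(c) are isolated as the abstract calculus lemma `tilt_calculus` about any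
family `L : ℝ → ℝ → ℕ → ℕ → ℝ` with the derivative relations of (a).

References (for the device as a correlation-inequality mechanism, not for any claim beyond the
proof above): J. Ginibre, CMP 16 (1970) 310–328 (inequalities by duplication).
-/

noncomputable section

open MeasureTheory Filter Set Metric
open scoped Topology

namespace Summit.AtomisticToContinuum.BoseEinsteinCondensation.Cruxes.TwoReplicaTransienceBound.AcrossCutThinning

section Calculus

/-- Mean value inequality on `[0,1]` for a function differentiable at every real point whose
derivative is `≤ B` on `(0,1)`: `f 1 - f 0 ≤ B`. -/
theorem sub_le_of_hasDerivAt_le (f f' : ℝ → ℝ) (B : ℝ) (hf : ∀ x, HasDerivAt f (f' x) x)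
    (hB : ∀ x, 0 < x → x < 1 → f' x ≤ B) : f 1 - f 0 ≤ B := by
  have hle : ∀ x ∈ interior (Icc (0 : ℝ) 1), deriv f x ≤ B := by
    intro x hx
    rw [interior_Icc] at hx
    rw [(hf x).deriv]
    exact hB x hx.1 hx.2
  have hmvt := (convex_Icc (0 : ℝ) 1).image_sub_le_mul_sub_of_deriv_le
    (fun x _ => (hf x).continuousAt.continuousWithinAt)
    (fun x _ => (hf x).differentiableAt.differentiableWithinAt)
    hle 0 (left_mem_Icc.2 zero_le_one) 1 (right_mem_Icc.2 zero_le_one) zero_le_one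
  simpa using hmvt

/-- Steps (b)–(c) of the device, abstractly: if `L s t i j` is positive at `(i,j) = (0,0)`, has
`∂ₛ L_{ij} = -L_{i+1,j}` and `∂ₜ L_{ij} = -L_{i,j+1}` everywhere, and
`L₁₁L₀₀ ≤ L₁₀L₀₁ + B·L₀₀²` on `[0,1]²`, then `L₀₀(1,1)L₀₀(0,0) ≤ e^{B} L₀₀(1,0)L₀₀(0,1)`
(mean value inequality twice, then exponentiate). -/
theorem tilt_calculus (L : ℝ → ℝ → ℕ → ℕ → ℝ) (B : ℝ) (hpos : ∀ s t, 0 < L s t 0 0)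
    (hds : ∀ t i j s, HasDerivAt (fun s => L s t i j) (-L s t (i + 1) j) s)
    (hdt : ∀ s i j t, HasDerivAt (fun t => L s t i j) (-L s t i (j + 1)) t)
    (hcov : ∀ s t : ℝ, 0 ≤ s → s ≤ 1 → 0 ≤ t → t ≤ 1 →
      L s t 1 1 * L s t 0 0 ≤ L s t 1 0 * L s t 0 1 + B * L s t 0 0 ^ 2) :
    L 1 1 0 0 * L 0 0 0 0 ≤ Real.exp B * (L 1 0 0 0 * L 0 1 0 0) := by
  -- (b) for fixed `t ∈ [0,1]`, `s ↦ -L₀₁/L₀₀` grows by at most `B` over `[0,1]`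
  have stepb : ∀ t, 0 ≤ t → t ≤ 1 →
      -L 1 t 0 1 / L 1 t 0 0 - -L 0 t 0 1 / L 0 t 0 0 ≤ B := by
    intro t ht0 ht1
    have hg : ∀ s, HasDerivAt (fun s => -L s t 0 1 / L s t 0 0)
        ((L s t 1 1 * L s t 0 0 - L s t 0 1 * L s t 1 0) / L s t 0 0 ^ 2) s := by
      intro s
      have h1 := (hds t 0 1 s).fun_neg
      have h0 := hds t 0 0 s
      simp only [zero_add] at h1 h0
      exact (h1.fun_div h0 (hpos s t).ne').congr_deriv (by ring)
    refine sub_le_of_hasDerivAt_le (fun s => -L s t 0 1 / L s t 0 0) _ B hg fun x hx0 hx1 => ?_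
    rw [div_le_iff₀ (pow_pos (hpos x t) 2)]
    linarith [hcov x t hx0.le hx1.le ht0 ht1]
  -- (c) `t ↦ log L₀₀(1,t) - log L₀₀(0,t)` has derivative `≤ B` on `[0,1]`
  have hh : ∀ t, HasDerivAt (fun t => Real.log (L 1 t 0 0) - Real.log (L 0 t 0 0))
      (-L 1 t 0 1 / L 1 t 0 0 - -L 0 t 0 1 / L 0 t 0 0) t := by
    intro t
    have h1 := (hdt 1 0 0 t).log (hpos 1 t).ne'
    have h0 := (hdt 0 0 0 t).log (hpos 0 t).ne'
    simp only [zero_add] at h1 h0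
    exact h1.fun_sub h0
  have key : Real.log (L 1 1 0 0) - Real.log (L 0 1 0 0) -
      (Real.log (L 1 0 0 0) - Real.log (L 0 0 0 0)) ≤ B :=
    sub_le_of_hasDerivAt_le (fun t => Real.log (L 1 t 0 0) - Real.log (L 0 t 0 0)) _ B hh
      fun x hx0 hx1 => stepb x hx0.le hx1.le
  have ha := hpos 1 1
  have hb := hpos 0 1
  have hc := hpos 1 0
  have hd := hpos 0 0
  have hR : 0 < Real.exp B * (L 1 0 0 0 * L 0 1 0 0) := by positivity
  rw [← Real.log_le_log_iff (mul_pos ha hd) hR, Real.log_mul ha.ne' hd.ne',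
    Real.log_mul (Real.exp_pos B).ne' (mul_pos hc hb).ne', Real.log_mul hc.ne' hb.ne',
    Real.log_exp]
  linarith

end Calculus

section Pointwise

variable {Ω : Type*} {A A' : Ω → ℝ} {M : ℝ}

/-- Pointwise bound on the tilted integrand for `0 ≤ A, A' ≤ M`:
`|A^i A'^j e^{-(sA+tA')}| ≤ M^i M^j e^{|s|M+|t|M}`. -/
theorem norm_tiltIntegrand_le (hA0 : ∀ ω, 0 ≤ A ω) (hA'0 : ∀ ω, 0 ≤ A' ω)
    (hM : ∀ ω, A ω ≤ M ∧ A' ω ≤ M) (s t : ℝ) (i j : ℕ) (ω : Ω) :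
    ‖A ω ^ i * A' ω ^ j * Real.exp (-(s * A ω + t * A' ω))‖ ≤
      M ^ i * M ^ j * Real.exp (|s| * M + |t| * M) := by
  have hA := hA0 ω
  have hA' := hA'0 ω
  obtain ⟨hAM, hA'M⟩ := hM ω
  have hM0 : 0 ≤ M := hA.trans hAM
  rw [Real.norm_eq_abs, abs_of_nonneg (by positivity)]
  have h1 : -(s * A ω) ≤ |s| * M :=
    calc -(s * A ω) ≤ |s * A ω| := neg_le_abs _
      _ = |s| * A ω := by rw [abs_mul, abs_of_nonneg hA]
      _ ≤ |s| * M := by gcongr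
  have h2 : -(t * A' ω) ≤ |t| * M :=
    calc -(t * A' ω) ≤ |t * A' ω| := neg_le_abs _
      _ = |t| * A' ω := by rw [abs_mul, abs_of_nonneg hA']
      _ ≤ |t| * M := by gcongr
  have h3 : -(s * A ω + t * A' ω) ≤ |s| * M + |t| * M := by linarith
  gcongr

end Pointwise

section Device

variable {Ω : Type*} [MeasurableSpace Ω] (μ : Measure Ω) {A A' : Ω → ℝ} {M : ℝ}

/-- Symmetry of the tilted moments under `(A, s, i) ↔ (A', t, j)`:
`M_{ij}[A,A'](s,t) = M_{ji}[A',A](t,s)`. -/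
theorem tiltLaplace_swap (A A' : Ω → ℝ) (s t : ℝ) (i j : ℕ) :
    tiltLaplace μ A A' s t i j = tiltLaplace μ A' A t s j i := by
  unfold tiltLaplace
  congr 1
  funext ω
  rw [add_comm (t * A' ω) (s * A ω)]
  ring

/-- On the zero measure every tilted moment vanishes. -/
theorem tiltLaplace_zero_measure (A A' : Ω → ℝ) (s t : ℝ) (i j : ℕ) :
    tiltLaplace (0 : Measure Ω) A A' s t i j = 0 := by
  unfold tiltLaplace
  exact integral_zero_measure _

/-- The tilted integrand `A^i A'^j e^{-(sA+tA')}` is measurable. -/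
theorem measurable_tiltIntegrand (hA : Measurable A) (hA' : Measurable A') (s t : ℝ) (i j : ℕ) :
    Measurable fun ω => A ω ^ i * A' ω ^ j * Real.exp (-(s * A ω + t * A' ω)) := by
  fun_prop

/-- The tilted integrand is integrable (bounded and measurable on a finite measure). -/
theorem integrable_tiltIntegrand [IsFiniteMeasure μ] (hA : Measurable A) (hA' : Measurable A')
    (hA0 : ∀ ω, 0 ≤ A ω) (hA'0 : ∀ ω, 0 ≤ A' ω) (hM : ∀ ω, A ω ≤ M ∧ A' ω ≤ M) (s t : ℝ)
    (i j : ℕ) : Integrable (fun ω => A ω ^ i * A' ω ^ j * Real.exp (-(s * A ω + t * A' ω))) μ :=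
  Integrable.mono' (integrable_const (M ^ i * M ^ j * Real.exp (|s| * M + |t| * M)))
    (measurable_tiltIntegrand hA hA' s t i j).aestronglyMeasurable
    (Eventually.of_forall fun ω => norm_tiltIntegrand_le hA0 hA'0 hM s t i j ω)

/-- For `μ ≠ 0` the tilted mass `Λ(s,t) = M₀₀(s,t)` is positive at every real `(s,t)`. -/
theorem tiltLaplace_zero_zero_pos [IsFiniteMeasure μ] [NeZero μ] (hA : Measurable A)
    (hA' : Measurable A') (hA0 : ∀ ω, 0 ≤ A ω) (hA'0 : ∀ ω, 0 ≤ A' ω)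
    (hM : ∀ ω, A ω ≤ M ∧ A' ω ≤ M) (s t : ℝ) : 0 < tiltLaplace μ A A' s t 0 0 := by
  have hint := integrable_tiltIntegrand μ hA hA' hA0 hA'0 hM s t 0 0
  unfold tiltLaplace
  simp only [pow_zero, one_mul] at hint ⊢
  exact integral_exp_pos hint

/-- (a) Differentiation under the integral sign in the first tilt parameter:
`∂ₛ M_{ij}(s,t) = -M_{i+1,j}(s,t)` at every real `s₀`. -/
theorem hasDerivAt_tiltLaplace_fst [IsFiniteMeasure μ] (hA : Measurable A) (hA' : Measurable A')
    (hA0 : ∀ ω, 0 ≤ A ω) (hA'0 : ∀ ω, 0 ≤ A' ω) (hM : ∀ ω, A ω ≤ M ∧ A' ω ≤ M) (t : ℝ) (i j : ℕ)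
    (s₀ : ℝ) :
    HasDerivAt (fun s => tiltLaplace μ A A' s t i j) (-tiltLaplace μ A A' s₀ t (i + 1) j) s₀ := by
  unfold tiltLaplace
  have key := hasDerivAt_integral_of_dominated_loc_of_deriv_le (μ := μ) (x₀ := s₀)
    (F := fun s ω => A ω ^ i * A' ω ^ j * Real.exp (-(s * A ω + t * A' ω)))
    (F' := fun s ω => -(A ω ^ (i + 1) * A' ω ^ j * Real.exp (-(s * A ω + t * A' ω))))
    (bound := fun _ => M ^ (i + 1) * M ^ j * Real.exp ((|s₀| + 1) * M + |t| * M))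
    (ball_mem_nhds s₀ one_pos) ?_ ?_ ?_ ?_ ?_ ?_
  · have h2 := key.2
    rw [integral_neg] at h2
    exact h2
  · exact Eventually.of_forall fun s =>
      (measurable_tiltIntegrand hA hA' s t i j).aestronglyMeasurable
  · exact integrable_tiltIntegrand μ hA hA' hA0 hA'0 hM s₀ t i j
  · exact (measurable_tiltIntegrand hA hA' s₀ t (i + 1) j).neg.aestronglyMeasurable
  · refine Eventually.of_forall fun ω s hs => ?_
    rw [norm_neg]
    refine (norm_tiltIntegrand_le hA0 hA'0 hM s t (i + 1) j ω).trans ?_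
    have hM0 : 0 ≤ M := (hA0 ω).trans (hM ω).1
    have hs' : |s| ≤ |s₀| + 1 := by
      have h1 := mem_ball.1 hs
      rw [Real.dist_eq] at h1
      have h2 := abs_sub_abs_le_abs_sub s s₀
      linarith
    gcongr
  · exact integrable_const _
  · refine Eventually.of_forall fun ω s _ => ?_
    exact (((((hasDerivAt_id' s).mul_const (A ω)).add_const (t * A' ω)).fun_neg.exp.const_mul
      (A ω ^ i * A' ω ^ j))).congr_deriv (by ring)

/-- (a') Differentiation under the integral sign in the second tilt parameter:
`∂ₜ M_{ij}(s,t) = -M_{i,j+1}(s,t)` at every real `t₀` (from (a) by `tiltLaplace_swap`). -/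
theorem hasDerivAt_tiltLaplace_snd [IsFiniteMeasure μ] (hA : Measurable A) (hA' : Measurable A')
    (hA0 : ∀ ω, 0 ≤ A ω) (hA'0 : ∀ ω, 0 ≤ A' ω) (hM : ∀ ω, A ω ≤ M ∧ A' ω ≤ M) (s : ℝ) (i j : ℕ)
    (t₀ : ℝ) :
    HasDerivAt (fun t => tiltLaplace μ A A' s t i j) (-tiltLaplace μ A A' s t₀ i (j + 1)) t₀ := by
  have h := hasDerivAt_tiltLaplace_fst μ hA' hA hA'0 hA0 (fun ω => (hM ω).symm) s j i t₀
  have hfun : (fun t => tiltLaplace μ A A' s t i j) = fun t => tiltLaplace μ A' A t s j i :=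
    funext fun t => tiltLaplace_swap μ A A' s t i j
  rw [hfun, tiltLaplace_swap μ A A' s t₀ i (j + 1)]
  exact h

end Device

/-- PROVED registered stub `stub_tiltFTC` — **the device**: on a finite measure space, for
bounded measurable `A, A' ≥ 0`, a bound `B` on the tilted covariance of `(A, A')` at all tilts
`(s,t) ∈ [0,1]²` (multiplicative form `M₁₁M₀₀ ≤ M₁₀M₀₁ + B·M₀₀²`) gives
`Λ(1,1)Λ(0,0) ≤ e^{B} Λ(1,0)Λ(0,1)` for `Λ(s,t) = ∫ e^{-sA-tA'} dμ`. -/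
theorem stub_tiltFTC : Goal.stub_tiltFTC := by
  intro Ω _ μ _ A A' hA hA' hA0 hA'0 hM B _hB hcov
  obtain ⟨M, hM⟩ := hM
  rcases eq_zero_or_neZero μ with hμ | _hμ
  · subst hμ
    simp only [tiltLaplace_zero_measure, mul_zero, le_refl]
  · exact tilt_calculus (tiltLaplace μ A A') B
      (fun s t => tiltLaplace_zero_zero_pos μ hA hA' hA0 hA'0 hM s t)
      (fun t i j s => hasDerivAt_tiltLaplace_fst μ hA hA' hA0 hA'0 hM t i j s)
      (fun s i j t => hasDerivAt_tiltLaplace_snd μ hA hA' hA0 hA'0 hM s i j t) hcov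

end Summit.AtomisticToContinuum.BoseEinsteinCondensation.Cruxes.TwoReplicaTransienceBound.AcrossCutThinning

end
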